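import Summits.QuantumFields.BalabanUV.T4Continuum.Spine.NE1p.DressedTowerWitnessAction
import Summits.QuantumFields.BalabanUV.T4Continuum.Spine.NE1p.DressedStabilityOfSliceWinSchedules

/-!
# T⁴ programme, spine estimate NE1′ (node O3b/H2) — A LIVE ACTION EXPONENT AT EVERY CUTOFF, part 2: the assembled slice-window
# END BY NAME on the datum of part 1, the bundle with W5's ONE `U`, END-B, the root and the all-cutoff face (formalisation crew
# `b2b-balaban-t4-ne1p-formalise-*`, leaf seat 03, generation 3, witness item W9; own-initiative consistency item, NOT a crew
# estimate row)

Cell `pub-balaban`, sub-cell `t4`, BINDER-OWNERS row NE1′ (owner lineage t4-ne1p-p1).  ADDITIVE — imports part 1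
`Spine/NE1p/DressedTowerWitnessAction` (the carried functionals `FnA` DEFINED by the dressed recursion with the live action exponent
`𝒜A U z = −U₀₀·z₀₀`, reality at `ref₁ = Re`, the monotonicity induction, the binders `hslA` ∕ `FnA_succ` ∕ `realBaseAt_A` ∕
`exponentSliceAt_A` (action margin `½` at every step) ∕ `hlinA` ∕ `hbirthA`; through it rows W7 ∕ W5 and leaf-04's
`DressedTransportAssembledModSliceWin`) and leaf-09's `Spine/NE1p/DressedStabilityOfSliceWinSchedules` (S3h part 2, p214712: the
all-cutoff face, for §3's `example`) ONLY; modifies nothing.  One namespace with part 1.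

CONTENTS.
* §1 **`htrA K`** — leaf-04's `transportLeaf_assembled_mod_swin_of_schedule Wm …` BY NAME on the datum at EVERY cutoff, with the LIVE
  action exponent in `hFn` ∕ `hB` ∕ `hE` (`𝒜 := 𝒜A`, `ref := ref₁`, **`s := ½` at every step**), attainment `hlinA` under the nonlinear
  dressing, the slice sizes `Asz := aszRec gen ½ 0` (growth `e^{3∕2}` per step — DATA; the per-step loss lives in `alphaCell`, the
  K-uniformity is untouched), observable coupling `c := 0` (declared in part 1).  Conclusion: the transport leaf `htr` gated by the
  dressed budget **`budgetGate (TM K) (fun _ _ => ½) ¼ {b} …`** — THE NUMBER in the gate (header-distinct from row W7's `htrM`,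
  whose gate carries `s ≡ 0`).
* §2 **`leavesA K : BookingLeaves UW (BM K) (TM K)`** — row S3's `bookingLeavesCell` with `s₀ := ½` (`hs₀ : ½ ≤ ½`, EQUALITY) and
  `htr := htrA K`, over row W5's ONE `UW` (whose (w6) smallness `¼·(1·1·(1−½)⁻¹) ≤ 1 − ½` is ALSO an equality: the dressed budget
  `s₀ + m·Σ envVar ≤ 1` closes with no slack on either side); `classAt_towerA` — END-B's per-cutoff face: the class AND every dressed
  budget gate WITH THE NUMBER along the trajectory, at every cutoff.
* §3 the root `DressedStability towerM` through END-B over `leavesA`, and the all-cutoff slice-win face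
  `dressedStabilityWith_swin_of_schedules towerM …` fed with part 1's families (`𝒜 := 𝒜A`, `ref := ref₁`, `s := ½`) — both as
  `example`s: their STATEMENTS are rows W7 ∕ W7c's landed `dressedStability_towerM` ∕ `dressedStabilityWith_towerM_allCutoffs` (the
  gate's dedup rule admits no second theorem with the same statement); these are new ROUTES to them through live (w2-act) data.

HONEST FRAMING.  A decided toy: [folklore] kernel glue, 0 sorry, 0 citations, no `def … : Prop` (the one `def` is a
`BookingLeaves`-valued TERM); `rel = Eq`, two-atom laws, zero regeneration, one family, observable coupling `0` — toy labelled toy;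
NOTHING of Bałaban's densities or of [Balaban1989LargeFieldII] (1.65)∕(1.71)–(1.75) is asserted (CONTEXT only).  Headline (c4):
«the (w2-act) families `hB`∕`hE`∕`hs₀` of the assembled slice-window face are inhabitable at EVERY cutoff by a LIVE complex action
exponent (reality only at `ref = Re`) with THE NUMBER `½` charged in full at every step — jointly with every other family of END-F′,
END-B and the all-cutoff face, ONE K-free `U`, ONE cutoff-free schedule; non-vacuity of SHAPES; NE1′ ⇐ the named binders, NOT
proved»; spine PROVED 0∕9.  Rung (B)+1 on ONE finite four-torus — NOT infinite volume, NOT a mass gap, NOT OS on ℝ⁴, NOT Clay, NOT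
summit progress.  HONEST DEPENDENCY: continuum YM on T⁴ ⇐ BetaPertH ∧ nine spine estimates (0/9 proved); BetaPertH ⇐ (D1) ∧ (D4) ∧
CAP+tail; G-an2-4 gates asym, D1 and NE2/3/4.
-/

noncomputable section

namespace Summit.QuantumFields.BalabanUV.T4Continuum.NE1p.DressedTowerWitnessAction

open MeasureTheory Set Metric Filter Finset
open scoped BigOperators
open Literature.MathematicalPhysics.QuantumFieldTheory.Balaban1983to89
open Literature.MathematicalPhysics.QuantumFieldTheory.Balaban1983to89.T4TermFormat
open Literature.MathematicalPhysics.QuantumFieldTheory.Balaban1983to89.T4TermFormat.Booking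
open Literature.MathematicalPhysics.QuantumFieldTheory.Balaban1983to89.T4GatedBooking
open Literature.MathematicalPhysics.QuantumFieldTheory.Balaban1983to89.T4TrajectoryComparison
open T4TrajectoryModulus (bondBall bondBall_add_mem bondBall_latMove_add_mem bondBall_diam)
open T4BlockTransport (Fld NDir latMove latN Site norm_dir_le)
open T4BirthChartTransport (GaugeInvariant BirthSlice RelGauge)
open T4TrajectoryDensity
open Summit.QuantumFields.BalabanUV.T4Continuum.T4TrajectoryDensityDressed
open Summit.QuantumFields.BalabanUV.T4Continuum.T4TrajectoryDensityWitness
open Summit.QuantumFields.BalabanUV.T4Continuum.NE1p.DressedRoot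
open Summit.QuantumFields.BalabanUV.T4Continuum.NE1p.DressedUniformConstants
open Summit.QuantumFields.BalabanUV.T4Continuum.NE1p.DressedWindowScheduleWin
open Summit.QuantumFields.BalabanUV.T4Continuum.NE1p.DressedWindowScheduleModWin
open Summit.QuantumFields.BalabanUV.T4Continuum.NE1p.DressedTowerWitness
open Summit.QuantumFields.BalabanUV.T4Continuum.NE1p.DressedTowerWitnessSlice
open Summit.QuantumFields.BalabanUV.T4Continuum.NE1p.DressedTransportAssembledModData
open Summit.QuantumFields.BalabanUV.T4Continuum.NE1p.DressedTransportAssembledModSliceWin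
open Summit.QuantumFields.BalabanUV.T4Continuum.NE1p.DressedStabilityOfSliceWinSchedules

/-! ## §1 The assembled slice-window END BY NAME, live action exponent, THE NUMBER in the gate [folklore] -/

/-- **END-F′-mod-swin ON THE DATUM WITH A LIVE ACTION EXPONENT, AT EVERY CUTOFF** — leaf-04's
`transportLeaf_assembled_mod_swin_of_schedule Wm …` BY NAME: `hFn` = `FnA_succ` (the dressed recursion with background-dependent
complex weights, an EQUATION at every background), (w2-act) `hB` = `realBaseAt_A` (`ref := ref₁ = Re`), `hE` = `exponentSliceAt_A`
with the action margin **`s := ½` at every step of every cutoff**, attainment `hlinA` (monotonicity of the dressing), births `hslA`,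
the (I4′) links ∕ fresh pairs ∕ (w4) of row W7 verbatim, `Asz := aszRec gen ½ 0`, observable coupling `c := 0` (declared).  Conclusion:
the transport leaf `htr` at `C = 4·½∕1`, rate `ψ·alphaCell ½`, gated by the dressed budget WITH THE NUMBER `s ≡ ½`, `m = ¼`. [folklore] -/
theorem htrA (K : ℕ) :
    (TM K).TransportsFromVar (4 * (1 / 2) / 1) (fun i => (LW ^ 2)⁻¹ * (fun _ : ℕ => alphaCell (1 / 2)) i)
      (budgetGate (TM K) (fun _ _ => 1 / 2) (1 / 4) (fun _ b => {b}) (4 * (1 / 2) / 1)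
        (fun i => (LW ^ 2)⁻¹ * (fun _ : ℕ => alphaCell (1 / 2)) i)) :=
  transportLeaf_assembled_mod_swin_of_schedule Wm (T := TM K) (Fn := fun _ k' k => FnA K k' k)
    (rel := fun _ _ _ U U' => U = U') (ref := fun _ _ U => ref₁ U) (base := fun _ _ => base₁) (𝒜 := fun _ _ => 𝒜A)
    (𝒬 := fun _ _ => zeroExp) (q := fun _ _ _ => 0) (μ := fun _ k => flAt (atomW (k + 1))) (z₀ := fun _ _ => 0)
    (z₁ := fun _ _ => 0) (defect := fun _ _ k => defW (k + 1)) (cδ := 1 / 2) (ψ := (LW ^ 2)⁻¹) (m := 1 / 4)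
    (s := fun _ _ => 1 / 2) (s1 := fun _ _ => 0) (α := fun _ : ℕ => alphaCell (1 / 2))
    (Asz := aszRec (TM K).gen (fun _ _ => 1 / 2) (fun _ _ => 0)) (S := fun _ b => {b}) (Sg := fun _ b => {(b, 0)})
    (c := fun _ _ => (0 : ℂ)) (δf := fun _ k _ => dfW k)
    (fun _ => alphaCell_nonneg (by norm_num)) one_pos (by norm_num) psi_pos.le
    (fun b k' _ _ _ => birthSlice_anti_window (hslA K b k') (Wm.hwcw k'))
    (fun _ k' k _ _ _ _ U => FnA_succ K k' k U) (fun _ _ k _ _ _ _ _ => mem_bddClass_flAt _ _)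
    (fun _ _ k _ _ _ _ => realBaseAt_A k _) (fun _ _ k _ _ _ _ => exponentSliceAt_A k)
    (fun _ _ => by funext U z; simp [zeroExp]) (hSgM K) (fun _ _ => by simp)
    (fun f k'' => aszRec_birth (TM K).gen (fun _ _ => 1 / 2) (fun _ _ => 0) f k'')
    (fun f _ _ _ hk => aszRec_succ (TM K).gen (fun _ _ => 1 / 2) (fun _ _ => 0) f hk) (fun _ _ => by simp)
    (fun b k p hp => hδfM K k b p hp) (fun _ k _ _ => hδfwkM k) (fun _ k => hDμM k) (fun _ k => hz₁M k)
    (fun _ _ k _ _ _ _ U₀ _ pd _ _ => (relGauge_pairs k).mono fun z hz t _ => hz (latMove U₀ pd t))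
    (fun k hk => hdomM K k hk) (fun _ _ _ _ _ h => h ▸ rfl) (fun _ _ _ k _ => aesm_flAt _ _) (fun _ _ k => hdefwkM k)
    (fun _ k' k _ _ _ => hrateM k' k) (fun b k' k _ _ _ _ ε hε => hlinA K b k' k ε hε)

/-! ## §2 The bundle with W5's ONE `U`, THE NUMBER as the action margin; END-B's per-cutoff face [folklore] -/

/-- **THE LEAF BUNDLE AT CUTOFF `K` WITH ROW W5's ONE `U` AND THE NUMBER AS ACTION MARGIN** — row S3's `bookingLeavesCell` with
`s₀ := ½` (`hs₀ : ½ ≤ s̄⁰ = ½`, equality), `htr := htrA K`, `hbirth := hbirthA K _`, `hreg := hregM K _`, `hcount := hcountM K`;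
ONE `UW` for the window face (W5), the assembled face (W7) AND the live-action face (here), at every cutoff. [folklore] -/
def leavesA (K : ℕ) : BookingLeaves UW (BM K) (TM K) :=
  bookingLeavesCell one_le_LW (by norm_num) le_rfl (by norm_num) zero_le_one zero_le_one (by norm_num) (locCell_LW _).le
    (by norm_num) (by norm_num) (fun _ => 0) (fun _ _ => 1 / 2) (fun _ b => {b}) (fun _ => le_rfl) (fun _ _ => le_rfl)
    (fun k _ _ _ => Nat.zero_le k) (hcountM K) (fun _ _ => le_rfl) (hbirthA K _) (htrA K) (hregM K _)

/-- **END-B's PER-CUTOFF FACE ON THE LIVE-ACTION DATUM**: the class AND every dressed budget gate WITH THE NUMBER `½` along the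
trajectory, at every cutoff (`classAt_of_bookingLeaves` BY NAME). [folklore] -/
theorem classAt_towerA (K : ℕ) :
    ClassAt (BM K) UW.A₀ UW.ρ₁ UW.τ ∧ ∀ k, k ≤ (BM K).K → RanBelow (budgetGate (TM K) (leavesA K).s₀ UW.m (leavesA K).S UW.C
      (leavesA K).ρ) k :=
  classAt_of_bookingLeaves (leavesA K)

/-- THE DRESSED BUDGET WITH THE NUMBER IS MET AT EVERY SCALE OF EVERY CUTOFF [folklore]: `½ + ¼·Σ_{f ∈ {b}} envVar … ≤ 1` for the
live family, read off `classAt_towerA`. -/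
theorem budgetGate_towerA (K k : ℕ) (hk : k < (BM K).K) :
    budgetGate (TM K) (fun _ _ => 1 / 2) (1 / 4) (fun _ b => {b}) (4 * (1 / 2) / 1)
      (fun _ : ℕ => (LW ^ 2)⁻¹ * alphaCell (1 / 2)) k :=
  (classAt_towerA K).2 (k + 1) hk k (Nat.lt_succ_self k)

/-! ## §3 The root and the all-cutoff face through the live-action data (new routes to landed statements) [folklore] -/

/-- THE ROOT THROUGH THE LIVE-ACTION BUNDLES — `DressedStability towerM` by row S3's `dressedStability_of_cell` over `leavesA` (an
`example`: the statement is row W7's landed `dressedStability_towerM`; this is a new ROUTE to it). [folklore] -/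
example : DressedStability towerM :=
  dressedStability_of_cell towerM one_le_LW (by norm_num) le_rfl (by norm_num : (0 : ℝ) ≤ 1 / 2) zero_le_one zero_le_one
    (by norm_num) (locCell_LW _).le (by norm_num) (by norm_num) fun _ K => leavesA K

/-- THE ALL-CUTOFF SLICE-WINDOW FACE THROUGH THE LIVE-ACTION DATA — leaf-09's `dressedStabilityWith_swin_of_schedules towerM …` fed with
part 1's `(p, K)`-families (`𝒜 := 𝒜A`, `ref := ref₁`, `s := ½`, `c := 0`), ONE schedule, the scalars of `UW` once (an `example`: the
statement is W7c's landed `dressedStabilityWith_towerM_allCutoffs`).  So S3h-2's ≈ 45 families are jointly inhabited ALSO with live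
(w2-act) data. [folklore] -/
example : DressedStabilityWith towerM 1 (rhoOne (LW ^ 2)⁻¹ (4 * (1 / 2) / 1) 0 (1 / 2)) (LW⁻¹ ^ 3) :=
  dressedStabilityWith_swin_of_schedules towerM (κ := 1 / 2) (L := LW) (cbar := 0) (N₀ := 1) (A₀ := 1) (sbar := 1 / 2)
    (ρ' := 1 / 2) (r := 1) (cδ := 1 / 2) (m := 1 / 4) (w := fun _ _ => 1) (fun _ _ => Wm)
    (Fn := fun _ K _ k' k => FnA K k' k) (rel := fun _ _ _ _ _ U U' => U = U') (ref := fun _ _ _ _ U => ref₁ U)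
    (base := fun _ _ _ _ => base₁) (𝒜 := fun _ _ _ _ => 𝒜A) (𝒬 := fun _ _ _ _ => zeroExp) (q := fun _ _ _ _ _ => 0)
    (μ := fun _ _ _ k => flAt (atomW (k + 1))) (z₀ := fun _ _ _ _ => 0) (z₁ := fun _ _ _ _ => 0)
    (defect := fun _ _ _ _ k => defW (k + 1)) (s := fun _ _ _ _ => 1 / 2) (s1 := fun _ _ _ _ => 0)
    (Asz := fun _ K => aszRec (TM K).gen (fun _ _ => 1 / 2) (fun _ _ => 0)) (S := fun _ _ _ b => {b})
    (Sg := fun _ _ _ b => {(b, 0)}) (c := fun _ _ _ _ => (0 : ℂ)) (δf := fun _ _ _ k _ => dfW k) (creg := fun _ _ _ => 0)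
    (fun _ _ => hratioM) one_le_LW le_rfl (by norm_num) zero_le_one zero_le_one (by norm_num) (locCell_LW _).le (by norm_num)
    (by norm_num) one_pos (by norm_num)
    (fun _ K b k' _ _ _ => birthSlice_anti_window (hslA K b k') (Wm.hwcw k'))
    (fun _ K _ k' k _ _ _ _ U => FnA_succ K k' k U) (fun _ _ _ _ k _ _ _ _ _ => mem_bddClass_flAt _ _)
    (fun _ _ _ _ k _ _ _ _ => realBaseAt_A k _) (fun _ _ _ _ k _ _ _ _ => exponentSliceAt_A k)
    (fun _ _ _ _ => by funext U z; simp [zeroExp]) (fun _ K => hSgM K) (fun _ _ _ _ => by simp)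
    (fun _ K f k'' => aszRec_birth (TM K).gen (fun _ _ => 1 / 2) (fun _ _ => 0) f k'')
    (fun _ K f _ _ _ hk => aszRec_succ (TM K).gen (fun _ _ => 1 / 2) (fun _ _ => 0) f hk) (fun _ _ _ _ => by simp)
    (fun _ K b k x hx => hδfM K k b x hx) (fun _ _ _ k _ _ => hδfwkM k) (fun _ _ _ k => hDμM k) (fun _ _ _ k => hz₁M k)
    (fun _ _ _ _ k _ _ _ _ U₀ _ pd _ _ => (relGauge_pairs k).mono fun z hz t _ => hz (latMove U₀ pd t))
    (fun _ _ _ _ _ _ _ h => h ▸ rfl) (fun _ _ _ _ _ k _ => aesm_flAt _ _) (fun _ _ _ _ k => hdefwkM k)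
    (fun _ _ _ k' k _ _ _ => hrateM k' k) (fun _ K b k' k _ _ _ _ ε hε => hlinA K b k' k ε hε)
    (fun _ _ _ => le_rfl) (fun _ _ _ _ => le_rfl) (fun _ K => hregM K _) (fun _ _ _ _ => le_rfl)
    (fun _ _ k _ _ _ => Nat.zero_le k) (fun _ K => hcountM K) (fun _ K => hbirthA K _)

end Summit.QuantumFields.BalabanUV.T4Continuum.NE1p.DressedTowerWitnessAction

end
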